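/-
Copyright: cell pub-balaban-gaps, seat ne8 (estimate NE7c), gen 17. Project licence.
-/
import Summits.QuantumFields.BalabanUV.T4Continuum.Spine.NE7c.LiveFactorSUNSmallBallConstant

/-!
# THE TRACE-WINDOW CONSTANT OF `SU(N)` VALUED FOR EVERY `N ≥ 2`: `Haar_{SU(N)}{Re tr(1 − V) ≤ t} ∕ (√t)^{N²−1} → (√2)^{N²−1}·C₀(N)` — EXACTLY the hypothesis of
# ne6's V48 `CompactFibrePlaquetteMassSUNLimit.tendsto_scaled_plaquetteMass_SUN_of_window`, with the ONE-PLAQUETTE CONSTANT in closed form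
# `K_N = (√2)^{N²−1}·C₀(N)·Γ((N²+1)∕2) = ∏_{j<N} j! ∕ (2π)^{N(N+1)∕2} · (2√N·π∕N) · (√(2π))^{N²−1}`, `K_2 = 1∕(2√π)`, `K_3 = 1∕(√3·π)` (row NE7c, (vi′) corollary; [folklore])

Cell `pub-balaban-gaps` (G2), seat ne8, estimate **NE7c**.  Proof-only file under `Spine/NE7c/`: imports this seat's file 44 `LiveFactorSUNSmallBallConstant` (`C₀(SU(N))` valued) and,
through it, file 36 `LiveFactorWindowTightSUN` (`tendsto_haar_traceWindow_div_sqrt_pow`, hypothesis form) — BY NAME.  It does NOT import ne6's V48 (whose hub olean was absent at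
the time of writing): V48's two theorems `tendsto_scaled_plaquetteMass_SUN_of_window` ∕ `tendsto_freeEnergy_constant_SUN_of_window` take precisely
`tendsto_haar_traceWindow_div_sqrt_pow_valued` below as their hypothesis `hC`, so `(√β)^{N²−1}·Z_N(β) → K_N` and `−log Z_N(β) − ((N²−1)∕2)·log β → −log K_N` are
ONE-LINE applications on their side (or in the follow-up file `LiveFactorSUNPlaquetteMassConstant`).  No `def`; 0 `sorry`.

THIS FILE ([folklore]; `N ≥ 2`):
* **`tendsto_haar_traceWindow_div_sqrt_pow_valued`** — `Haar_{SU(N)}{Re tr(1 − V) ≤ t} ∕ (√t)^{N²−1} → (√2)^{N²−1}·c_N·(2√N·π∕N)·(√π)^{N²−1}∕Γ((N²−1)∕2+1)`;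
* **`plaquetteMass_const_eq`** — `(√2)^{N²−1}·C₀(N)·Γ((N²−1)∕2+1) = ∏_{j<N} j! ∕ (2π)^{N(N+1)∕2} · (2√N·π∕N) · (√(2π))^{N²−1}` (the `Γ`'s cancel);
* `plaquetteMass_const_two_eq` (`K_2 = 1∕(2√π)`, ne6's `CompactFibrePlaquetteMassSU2Sharp` constant by an independent route), `plaquetteMass_const_three_eq` (`K_3 = 1∕(√3·π)`:
  `Z_{SU(3)}(β) ~ β^{−4}∕(√3·π)`).

* §2 (v1.1, append-only): **`plaquetteMass_const_eq_barnes`** ∕ **`plaquetteMass_const_barnes`** (`N ≥ 1`) — the constant COLLECTED to a Barnes `G`-value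
  **`K_N = ∏_{j<N} j! ∕ (√N·(2π)^{(N−1)∕2}) = G(N+1)∕(√N·(2π)^{(N−1)∕2})`** (`K_4 = 6∕(2π)^{3∕2}`, `K_5 = 288∕(√5·(2π)²)`, `K_6 = 142.6`): the Gaussian
  tangent-space prediction `(2π)^{(N²−1)∕2}∕vol_HS SU(N)`, now a theorem for every `N ≥ 2` via V48.

HONEST: Haar asymptotics of the compact group `SU(N)` ([folklore]); nothing of the interacting measure, nothing of Bałaban's; census-neutral for road (δ).  NE7c NOT proved; WORD
UNCHANGED (WORK-bound behind node O; INSTANCE 0∕1); spine 0∕9; one finite T⁴ — NOT ℝ⁴, NOT infinite volume, NOT the mass gap, NOT Clay.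
-/

set_option autoImplicit false

noncomputable section

open scoped Matrix.Norms.Frobenius Real Topology
open MeasureTheory Set Filter
open Literature.MathematicalPhysics.QuantumFieldTheory (haarProbability)
open Literature.MathematicalPhysics.QuantumFieldTheory.UnitaryCayley (haarChartConst)
open Literature.MathematicalPhysics.QuantumFieldTheory.UnitaryColumn (haarChartConst_eq)
open Summit.QuantumFields.BalabanUV.T4Continuum.Spine.NE7c.LiveFactorWindowTightSUN (tendsto_haar_traceWindow_div_sqrt_pow)
open Summit.QuantumFields.BalabanUV.T4Continuum.Spine.NE7c.LiveFactorSUNSmallBallConstant (tendsto_haar_sball_div_pow_const)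

namespace Summit.QuantumFields.BalabanUV.T4Continuum.Spine.NE7c.LiveFactorSUNTraceWindowConstant

variable {N : ℕ}

/-- **THE TRACE-WINDOW CONSTANT VALUED** (`N ≥ 2`): `Haar_{SU(N)}{Re tr(1 − V) ≤ t} ∕ (√t)^{N²−1} → (√2)^{N²−1} · c_N · (2√N π∕N) · (√π)^{N²−1}∕Γ((N²−1)∕2+1)`
as `t → 0⁺`. [folklore] -/
theorem tendsto_haar_traceWindow_div_sqrt_pow_valued (hN : 2 ≤ N) :
    Tendsto (fun t : ℝ => (haarProbability (Matrix.specialUnitaryGroup (Fin N) ℂ)).real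
        {V : Matrix.specialUnitaryGroup (Fin N) ℂ | (Matrix.trace (1 - (V : Matrix (Fin N) (Fin N) ℂ))).re ≤ t} / Real.sqrt t ^ (N ^ 2 - 1))
      (𝓝[>] 0)
      (𝓝 (Real.sqrt 2 ^ (N ^ 2 - 1) * ((haarChartConst N : ℝ) * (2 * Real.sqrt N * (π / N)) *
        (Real.sqrt π ^ (N * N - 1) / Real.Gamma ((N * N - 1 : ℕ) / 2 + 1))))) := by
  have h := tendsto_haar_traceWindow_div_sqrt_pow (tendsto_haar_sball_div_pow_const hN)
  refine ((tendsto_const_nhds (x := Real.sqrt 2 ^ (N ^ 2 - 1))).mul h).congr' ?_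
  filter_upwards [self_mem_nhdsWithin] with t ht
  have ht0 : 0 < t := Set.mem_Ioi.1 ht
  have hs : Real.sqrt (2 * t) = Real.sqrt 2 * Real.sqrt t := Real.sqrt_mul (by norm_num) t
  have h2 : 0 < Real.sqrt 2 ^ (N ^ 2 - 1) := pow_pos (Real.sqrt_pos.2 (by norm_num)) _
  rw [hs, mul_pow]
  field_simp

/-- **THE ONE-PLAQUETTE CONSTANT IN CLOSED FORM**: `(√2)^{N²−1}·C₀(N)·Γ((N²−1)∕2+1) = ∏_{j<N} j! ∕ (2π)^{N(N+1)∕2} · (2√N·π∕N) · (√(2π))^{N²−1}`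
(the `Γ`'s cancel; `(√2·√π)^{N²−1} = (√(2π))^{N²−1}`). [folklore] -/
theorem plaquetteMass_const_eq (N : ℕ) :
    Real.sqrt 2 ^ (N ^ 2 - 1) * ((haarChartConst N : ℝ) * (2 * Real.sqrt N * (π / N)) *
        (Real.sqrt π ^ (N * N - 1) / Real.Gamma ((N * N - 1 : ℕ) / 2 + 1))) * Real.Gamma (((N ^ 2 - 1 : ℕ) : ℝ) / 2 + 1)
      = (∏ j ∈ Finset.range N, (j.factorial : ℝ)) / (2 * π) ^ (N * (N + 1) / 2) * (2 * Real.sqrt N * (π / N)) * Real.sqrt (2 * π) ^ (N ^ 2 - 1) := by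
  have hn : N ^ 2 - 1 = N * N - 1 := by rw [sq]
  have hΓ : Real.Gamma ((N * N - 1 : ℕ) / 2 + 1) ≠ 0 := (Real.Gamma_pos_of_pos (by positivity)).ne'
  rw [hn, haarChartConst_eq N, Real.sqrt_mul (by norm_num : (0 : ℝ) ≤ 2) π, mul_pow]
  field_simp
  ring

/-- **CROSS-CHECK AT `N = 2`**: the valued one-plaquette constant is `1∕(2√π)` — ne6's sharp `SU(2)` ceiling constant (`Z_{SU(2)}(β) < (2√π)⁻¹·β^{−3∕2}`,
`CompactFibrePlaquetteMassSU2Sharp`) by an independent route. [folklore] -/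
theorem plaquetteMass_const_two_eq :
    (∏ j ∈ Finset.range 2, (j.factorial : ℝ)) / (2 * π) ^ (2 * (2 + 1) / 2) * (2 * Real.sqrt 2 * (π / 2)) * Real.sqrt (2 * π) ^ (2 ^ 2 - 1)
      = 1 / (2 * Real.sqrt π) := by
  have h2 : Real.sqrt 2 * Real.sqrt 2 = 2 := Real.mul_self_sqrt (by norm_num)
  have hπ : Real.sqrt π * Real.sqrt π = π := Real.mul_self_sqrt Real.pi_pos.le
  have hsπ : 0 < Real.sqrt π := Real.sqrt_pos.2 Real.pi_pos
  have hs2 : 0 < Real.sqrt 2 := Real.sqrt_pos.2 (by norm_num)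
  have hsq : Real.sqrt (2 * π) ^ (2 ^ 2 - 1) = 2 * π * (Real.sqrt 2 * Real.sqrt π) := by
    rw [show 2 ^ 2 - 1 = 2 + 1 by norm_num, pow_succ, Real.sq_sqrt (by positivity), Real.sqrt_mul (by norm_num : (0 : ℝ) ≤ 2) π]
  rw [hsq]
  simp only [Finset.prod_range_succ, Finset.prod_range_zero, Nat.factorial_zero, Nat.factorial_one, Nat.cast_one, one_mul,
    show 2 * (2 + 1) / 2 = 3 by norm_num]
  have hab : Real.sqrt 2 ^ 2 * Real.sqrt π ^ 2 = 2 * π := by rw [sq, sq, h2, hπ]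
  field_simp
  linear_combination hab

/-- **THE VALUE AT `N = 3`** (`SU(3)`): `K_3 = 2∕(2π)^6 · (2√3·π∕3) · (2π)^4 = 1∕(√3·π)` — `Z_{SU(3)}(β) ~ β^{−4}∕(√3·π)` as `β → ∞`. [folklore] -/
theorem plaquetteMass_const_three_eq :
    (∏ j ∈ Finset.range 3, (j.factorial : ℝ)) / (2 * π) ^ (3 * (3 + 1) / 2) * (2 * Real.sqrt 3 * (π / 3)) * Real.sqrt (2 * π) ^ (3 ^ 2 - 1)
      = 1 / (Real.sqrt 3 * π) := by
  have h3 : Real.sqrt 3 * Real.sqrt 3 = 3 := Real.mul_self_sqrt (by norm_num)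
  have hs3 : 0 < Real.sqrt 3 := Real.sqrt_pos.2 (by norm_num)
  have h2π : Real.sqrt (2 * π) ^ (3 ^ 2 - 1) = (2 * π) ^ 4 := by
    rw [show 3 ^ 2 - 1 = 2 * 4 by norm_num, pow_mul, Real.sq_sqrt (by positivity)]
  rw [h2π]
  simp only [Finset.prod_range_succ, Finset.prod_range_zero, Nat.factorial_zero, Nat.factorial_one, Nat.factorial_two, Nat.cast_one,
    Nat.cast_ofNat, one_mul, show 3 * (3 + 1) / 2 = 6 by norm_num]
  field_simp
  nlinarith [h3, Real.pi_pos, hs3, pow_pos Real.pi_pos 4]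

/-! ## §2 (v1.1, append-only) The constant COLLECTED: `K_N = ∏_{j<N} j! ∕ (√N·(2π)^{(N−1)∕2}) = G(N+1) ∕ (√N·(2π)^{(N−1)∕2})` (Barnes `G`) -/

/-- **ARITHMETIC OF THE WINDOW FACTOR**: `2·√N·(π∕N) = 2π∕√N` (`N ≥ 1`). -/
theorem two_mul_sqrt_mul_pi_div (hN : 1 ≤ N) : 2 * Real.sqrt N * (π / N) = 2 * π / Real.sqrt N := by
  have hN0 : (0 : ℝ) < N := by exact_mod_cast hN
  have hs : 0 < Real.sqrt N := Real.sqrt_pos.2 hN0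
  have hsN : Real.sqrt N * Real.sqrt N = N := Real.mul_self_sqrt hN0.le
  rw [eq_div_iff hs.ne']
  calc 2 * Real.sqrt N * (π / N) * Real.sqrt N = 2 * π * (Real.sqrt N * Real.sqrt N) / N := by ring
    _ = 2 * π := by rw [hsN, mul_div_assoc, div_self hN0.ne', mul_one]

/-- **THE ONE-PLAQUETTE CONSTANT IS A BARNES `G`-VALUE** (`N ≥ 1`; pure arithmetic on `plaquetteMass_const_eq`'s right-hand side):
`∏_{j<N} j! ∕ (2π)^{N(N+1)∕2} · (2√N·π∕N) · (√(2π))^{N²−1} = ∏_{j<N} j! ∕ (√N·(2π)^{(N−1)∕2})` — the exponents of `2π` collect as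
`1 + (N²−1)∕2 − N(N+1)∕2 = −(N−1)∕2`, and `∏_{j<N} j! = G(N+1)` (Barnes).  Values: `K_1 = 1`, `K_2 = 1∕(2√π) = 0.2821`, `K_3 = 1∕(√3·π) = 0.1838`,
`K_4 = 6∕(2π)^{3∕2} = 0.3810`, `K_5 = 288∕(√5·(2π)²) = 3.262`, `K_6 = 34560∕(√6·(2π)^{5∕2}) = 142.6` — exactly the Gaussian tangent-space prediction
`(2π)^{(N²−1)∕2}∕vol_HS SU(N)` with `vol_HS SU(N) = √N·(2π)^{(N²+N−2)∕2}∕G(N+1)`. [folklore] -/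
theorem plaquetteMass_const_eq_barnes (hN : 1 ≤ N) :
    (∏ j ∈ Finset.range N, (j.factorial : ℝ)) / (2 * π) ^ (N * (N + 1) / 2) * (2 * Real.sqrt N * (π / N)) * Real.sqrt (2 * π) ^ (N ^ 2 - 1)
      = (∏ j ∈ Finset.range N, (j.factorial : ℝ)) / (Real.sqrt N * (2 * π) ^ (((N : ℝ) - 1) / 2)) := by
  have h2π : 0 < 2 * π := by positivity
  have hN0 : (0 : ℝ) < N := by exact_mod_cast hN
  have hs : 0 < Real.sqrt N := Real.sqrt_pos.2 hN0
  -- the three powers of `2π` as real powers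
  have hcast1 : (((N * (N + 1) / 2 : ℕ) : ℝ)) = (N : ℝ) * ((N : ℝ) + 1) / 2 := by
    rw [Nat.cast_div (Nat.even_mul_succ_self N).two_dvd (two_ne_zero)]
    push_cast
    ring
  have hcast2 : (((N ^ 2 - 1 : ℕ) : ℝ)) = (N : ℝ) ^ 2 - 1 := by
    rw [Nat.cast_sub (Nat.one_le_pow _ _ hN)]
    push_cast
    ring
  have he3 : ((2 * π) ^ (N * (N + 1) / 2) : ℝ) = (2 * π) ^ ((N : ℝ) * ((N : ℝ) + 1) / 2) := by
    rw [← hcast1, Real.rpow_natCast]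
  have he2 : Real.sqrt (2 * π) ^ (N ^ 2 - 1) = (2 * π) ^ (((N : ℝ) ^ 2 - 1) / 2) := by
    rw [Real.sqrt_eq_rpow, ← Real.rpow_natCast, ← Real.rpow_mul h2π.le, hcast2]
    congr 1
    ring
  have hkey : (2 * π) * (2 * π) ^ (((N : ℝ) ^ 2 - 1) / 2) * (2 * π) ^ (((N : ℝ) - 1) / 2) = (2 * π) ^ ((N : ℝ) * ((N : ℝ) + 1) / 2) := by
    rw [← Real.rpow_one_add' h2π.le (by nlinarith [hN0]), ← Real.rpow_add h2π]
    congr 1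
    ring
  have hp2 : 0 < (2 * π) ^ (((N : ℝ) - 1) / 2) := Real.rpow_pos_of_pos h2π _
  have hp3 : 0 < (2 * π) ^ ((N : ℝ) * ((N : ℝ) + 1) / 2) := Real.rpow_pos_of_pos h2π _
  rw [two_mul_sqrt_mul_pi_div hN, he3, he2, eq_div_iff (mul_pos hs hp2).ne']
  calc (∏ j ∈ Finset.range N, (j.factorial : ℝ)) / (2 * π) ^ ((N : ℝ) * ((N : ℝ) + 1) / 2) * (2 * π / Real.sqrt N)
          * (2 * π) ^ (((N : ℝ) ^ 2 - 1) / 2) * (Real.sqrt N * (2 * π) ^ (((N : ℝ) - 1) / 2))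
        = (∏ j ∈ Finset.range N, (j.factorial : ℝ)) * ((2 * π) * (2 * π) ^ (((N : ℝ) ^ 2 - 1) / 2) * (2 * π) ^ (((N : ℝ) - 1) / 2))
          / (2 * π) ^ ((N : ℝ) * ((N : ℝ) + 1) / 2) * (Real.sqrt N / Real.sqrt N) := by ring
    _ = ∏ j ∈ Finset.range N, (j.factorial : ℝ) := by
          rw [hkey, div_self hs.ne', mul_one, mul_div_assoc, div_self hp3.ne', mul_one]

/-- **THE ONE-PLAQUETTE CONSTANT, FINAL FORM** (`N ≥ 1`): `(√2)^{N²−1}·C₀(N)·Γ((N²−1)∕2+1) = ∏_{j<N} j! ∕ (√N·(2π)^{(N−1)∕2})` — V48's limit constant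
`C·Γ(d∕2+1)` (with `C` = `tendsto_haar_traceWindow_div_sqrt_pow_valued`'s window constant, `d = N² − 1`) as a Barnes `G`-value. [folklore] -/
theorem plaquetteMass_const_barnes (hN : 1 ≤ N) :
    Real.sqrt 2 ^ (N ^ 2 - 1) * ((haarChartConst N : ℝ) * (2 * Real.sqrt N * (π / N)) *
        (Real.sqrt π ^ (N * N - 1) / Real.Gamma ((N * N - 1 : ℕ) / 2 + 1))) * Real.Gamma (((N ^ 2 - 1 : ℕ) : ℝ) / 2 + 1)
      = (∏ j ∈ Finset.range N, (j.factorial : ℝ)) / (Real.sqrt N * (2 * π) ^ (((N : ℝ) - 1) / 2)) := by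
  rw [plaquetteMass_const_eq N, plaquetteMass_const_eq_barnes hN]

end Summit.QuantumFields.BalabanUV.T4Continuum.Spine.NE7c.LiveFactorSUNTraceWindowConstant
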